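import Mathlib
import HarnessLib
import Literature.Computability.Complexity.CircuitLowerBounds

/-!
# Route Circuit, crux CircuitSuperlinear (stmt-PneNP-0036), line Sketch — first rung under `stub_linRepSuperlinear`: linear representations of affine dispersers have dimension `≥ 0.63 (n − 2d)`

The open stub `stub_linRepSuperlinear` of the line (`Cruxes/CircuitSuperlinear/Lines/Sketch.lean`)
asks for an NP language whose slices afford no Karchmer–Wigderson linear representation
[KarchmerWigderson1993, Def. 9] of dimension parameter `t ≤ c · n`, for every `c`, infinitely
often. This file proves the first (linear, not superlinear) rung of that ladder for the explicit
family that holds the `B₂`-size record, affine dispersers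
(`Literature.Computability.Complexity.IsAffineDisperser`, Li–Yang STOC 2022):

* `card_sigmaSet`: Karchmer–Wigderson's 2-CNF `σ_t = y₁ ∧ ⋀ᵢ (y₂ᵢ ∨ y₂ᵢ₊₁)` has exactly `3 ^ t`
  satisfying assignments (coordinates `GF(2) × (GF(2)²)ᵗ`: first coordinate `1`, every pair
  nonzero);
* `two_pow_le_of_linRep_of_isAffineDisperser`: if `f : GF(2)ⁿ → {0,1}` is an affine disperser for
  dimension `d` and affords a linear representation `f(x) = 0 ⟺ P x ∈ Q ⊕ σ_t⁻¹(1)` (stated exactly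
  in the shape of the line's stubs, through `boolOfZMod2`), then `2 ^ (n + 1) ≤ 3 ^ t · 4 ^ d`, i.e.
  `t ≥ (n + 1 − 2d) / log₂ 3 ≈ 0.63 (n − 2d)`.

Proof (a volume argument, the linear-algebra twin of KW93 §2 Remark "`ρ(Ω) = O(log |Ω|)`"): with
`K := P⁻¹(Q)`, the zero set `Z = f⁻¹(0) = ⋃_{s ∈ σ_t⁻¹(1)} {x | s − P x ∈ Q}` is a union of at most
`3 ^ t` cosets of the single subspace `K`, each contained in `Z`; a disperser is non-constant on every
coset of dimension `≥ d`, so `dim K ≤ d − 1` and `|Z| ≤ 3 ^ t · 2 ^ (d-1)`, while `Z` meets every coset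
of a `d`-dimensional subspace, so `|Z| ≥ 2 ^ (n − d)`.

What this says for the line: the quantity that `stub_linRepSuperlinear` needs to be `ω(n)` is
provably `Ω(n)` (constant `1 / log₂ 3`) on explicit functions by a first-order (volume/degree-type)
argument — and, as the idea card `kw-linear-representation` records (barrier notes BN4/BN5), every
such argument stops at `O(n)`; the superlinear regime needs a second-order invariant that uses the
spanning condition. Not here: any statement about `NP` (the tree holds no explicit disperser in `NP`).
-/

set_option linter.dupNamespace false -- `Summit.PneNP.PneNP.…`: summit = sub-problem name (D-0017)

namespace Summit.PneNP.PneNP.Cruxes.CircuitSuperlinear.Sketch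

open Literature.Computability.Complexity Module

/-! ### Karchmer–Wigderson's `σ_t` has `3 ^ t` satisfying assignments -/

/-- Membership in the satisfying set `S_t = σ_t⁻¹(1)` of Karchmer–Wigderson's fixed 2-CNF
`σ_t = y₁ ∧ ⋀ᵢ (y₂ᵢ ∨ y₂ᵢ₊₁)`, in the coordinates `GF(2) × (GF(2)²)ᵗ` used by the line's stubs (first
coordinate `1`, every pair nonzero), written as a filtered `Finset`. [cite: KarchmerWigderson1993, §5 (Def. 9)] -/
theorem mem_sigmaSet {t : ℕ} (y : ZMod 2 × (Fin t → ZMod 2 × ZMod 2)) :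
    y ∈ (Finset.univ.filter fun y : ZMod 2 × (Fin t → ZMod 2 × ZMod 2) => y.1 = 1 ∧ ∀ j, y.2 j ≠ 0) ↔
      y.1 = 1 ∧ ∀ j, y.2 j ≠ 0 := by
  simp

/-- `GF(2)²` has exactly three nonzero vectors. [folklore] -/
theorem card_pair_ne_zero : Fintype.card {p : ZMod 2 × ZMod 2 // p ≠ 0} = 3 := by
  decide

/-- **`|σ_t⁻¹(1)| = 3 ^ t`.** [cite: KarchmerWigderson1993, §5] -/
theorem card_sigmaSet (t : ℕ) :
    (Finset.univ.filter fun y : ZMod 2 × (Fin t → ZMod 2 × ZMod 2) => y.1 = 1 ∧ ∀ j, y.2 j ≠ 0).card =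
      3 ^ t := by
  classical
  let emb : (Fin t → {p : ZMod 2 × ZMod 2 // p ≠ 0}) → ZMod 2 × (Fin t → ZMod 2 × ZMod 2) :=
    fun g => (1, fun j => (g j).1)
  have hinj : Function.Injective emb := by
    intro g g' h
    funext j
    exact Subtype.ext (congrFun (Prod.ext_iff.1 h).2 j)
  have hset : (Finset.univ.filter fun y : ZMod 2 × (Fin t → ZMod 2 × ZMod 2) => y.1 = 1 ∧ ∀ j, y.2 j ≠ 0) =
      Finset.univ.map ⟨emb, hinj⟩ := by
    ext y
    rw [mem_sigmaSet, Finset.mem_map]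
    constructor
    · rintro ⟨h1, h2⟩
      refine ⟨fun j => ⟨y.2 j, h2 j⟩, Finset.mem_univ _, ?_⟩
      exact Prod.ext h1.symm rfl
    · rintro ⟨g, -, rfl⟩
      exact ⟨rfl, fun j => (g j).2⟩
  rw [hset, Finset.card_map, Finset.card_univ, Fintype.card_fun, card_pair_ne_zero, Fintype.card_fin]

/-! ### The volume bound -/

/-- A nonempty affine subspace `x₀ + K` on which an affine disperser for dimension `d` is constant
has `dim K < d`. [cite: STOC2022, Def. in §1] -/
theorem finrank_lt_of_isAffineDisperser_const {n d : ℕ} {f : (Fin n → ZMod 2) → Bool}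
    (hf : IsAffineDisperser f d) (x₀ : Fin n → ZMod 2) (K : Submodule (ZMod 2) (Fin n → ZMod 2))
    (b : Bool) (hconst : ∀ k ∈ K, f (x₀ + k) = b) : Module.finrank (ZMod 2) K < d := by
  by_contra hd
  rw [not_lt] at hd
  have hdir : (AffineSubspace.mk' x₀ K).direction = K := AffineSubspace.direction_mk' x₀ K
  obtain ⟨x, hx, y, hy, hxy⟩ := hf (AffineSubspace.mk' x₀ K) (by rw [hdir]; exact hd)
    ⟨x₀, AffineSubspace.self_mem_mk' x₀ K⟩
  rw [AffineSubspace.mem_mk'] at hx hy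
  have hx' : f x = b := by
    have := hconst (x -ᵥ x₀) hx
    rwa [vsub_eq_sub, add_sub_cancel] at this
  have hy' : f y = b := by
    have := hconst (y -ᵥ x₀) hy
    rwa [vsub_eq_sub, add_sub_cancel] at this
  exact hxy (hx'.trans hy'.symm)

/-- The zero set of an affine disperser for dimension `d ≤ n` meets every coset of a `d`-dimensional
subspace, hence has at least `2 ^ (n - d)` points: `2 ^ n ≤ |f⁻¹(0)| · 2 ^ d`. [folklore] -/
theorem two_pow_le_card_zeros_mul {n d : ℕ} {f : (Fin n → ZMod 2) → Bool}
    (hf : IsAffineDisperser f d) (hdn : d ≤ n) :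
    2 ^ n ≤ (Finset.univ.filter fun x : Fin n → ZMod 2 => f x = false).card * 2 ^ d := by
  classical
  set Z := Finset.univ.filter fun x : Fin n → ZMod 2 => f x = false with hZ
  -- a `d`-dimensional coordinate subspace
  let v : Fin d → (Fin n → ZMod 2) := fun i => Pi.basisFun (ZMod 2) (Fin n) (Fin.castLE hdn i)
  have hv : LinearIndependent (ZMod 2) v :=
    (Pi.basisFun (ZMod 2) (Fin n)).linearIndependent.comp _ (Fin.castLE_injective hdn)
  set V : Submodule (ZMod 2) (Fin n → ZMod 2) := Submodule.span (ZMod 2) (Set.range v) with hVdef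
  have hVrank : Module.finrank (ZMod 2) V = d := by
    rw [hVdef, finrank_span_eq_card hv, Fintype.card_fin]
  have hcardV : Nat.card V = 2 ^ d := by
    rw [Module.natCard_eq_pow_finrank (K := ZMod 2), Nat.card_zmod, hVrank]
  have hcardE : Nat.card (Fin n → ZMod 2) = 2 ^ n := by
    rw [Nat.card_fun, Nat.card_zmod, Nat.card_eq_fintype_card, Fintype.card_fin]
  -- every coset of `V` contains a zero of `f`
  have hsurj : Function.Surjective fun x : Z => V.mkQ x.1 := by
    intro c
    obtain ⟨x₀, rfl⟩ := V.mkQ_surjective c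
    by_contra hno
    push Not at hno
    have hconst : ∀ k ∈ V, f (x₀ + k) = true := by
      intro k hk
      by_contra hfk
      have hfk' : f (x₀ + k) = false := by simpa using hfk
      have hmem : x₀ + k ∈ Z := by simp [hZ, hfk']
      refine hno ⟨x₀ + k, hmem⟩ ?_
      show V.mkQ (x₀ + k) = V.mkQ x₀
      rw [Submodule.mkQ_apply, Submodule.mkQ_apply, Submodule.Quotient.eq]
      simpa using hk
    have := finrank_lt_of_isAffineDisperser_const hf x₀ V true hconst
    omega
  have hle : Nat.card ((Fin n → ZMod 2) ⧸ V) ≤ Nat.card Z :=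
    Nat.card_le_card_of_surjective _ hsurj
  rw [Nat.card_eq_finsetCard] at hle
  have hmul := Submodule.card_eq_card_quotient_mul_card V
  rw [hcardE, hcardV] at hmul
  calc 2 ^ n = 2 ^ d * Nat.card ((Fin n → ZMod 2) ⧸ V) := hmul
    _ ≤ 2 ^ d * Z.card := Nat.mul_le_mul_left _ hle
    _ = Z.card * 2 ^ d := Nat.mul_comm _ _

/-- **First rung under `stub_linRepSuperlinear` (volume bound).** If an affine disperser
`f : GF(2)ⁿ → {0,1}` for dimension `d` affords a Karchmer–Wigderson linear representation with
dimension parameter `t` — a linear `P : GF(2)ⁿ → GF(2) × (GF(2)²)ᵗ` and a subspace `Q` with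
`f(x) = 0 ⟺ ∃ q ∈ Q, (P x + q).1 = 1 ∧ ∀ j, (P x + q).2 j ≠ 0`, written through `boolOfZMod2` exactly as
in the line's stubs — then `2 ^ (n + 1) ≤ 3 ^ t · 4 ^ d`, i.e. `t ≥ (n + 1 − 2 d) / log₂ 3`: the zero set is
a union of at most `3 ^ t` cosets of `K = P⁻¹(Q)`, each inside the zero set, so `dim K < d`, while
it has at least `2 ^ (n − d)` points. [folklore] -/
theorem two_pow_le_of_linRep_of_isAffineDisperser {n d t : ℕ} (f : (Fin n → ZMod 2) → Bool)
    (hf : IsAffineDisperser f d)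
    (P : (Fin n → ZMod 2) →ₗ[ZMod 2] (ZMod 2 × (Fin t → ZMod 2 × ZMod 2)))
    (Q : Submodule (ZMod 2) (ZMod 2 × (Fin t → ZMod 2 × ZMod 2)))
    (hrep : ∀ z : Fin n → Bool, (f ∘ boolOfZMod2) z = false ↔
      ∃ q ∈ Q, (P (boolOfZMod2 z) + q).1 = 1 ∧ ∀ j : Fin t, (P (boolOfZMod2 z) + q).2 j ≠ 0) :
    2 ^ (n + 1) ≤ 3 ^ t * 4 ^ d := by
  classical
  -- the representation over `GF(2)ⁿ`
  have hrep' : ∀ x : Fin n → ZMod 2, f x = false ↔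
      ∃ q ∈ Q, (P x + q).1 = 1 ∧ ∀ j : Fin t, (P x + q).2 j ≠ 0 := fun x => by
    simpa using hrep (boolOfZMod2.symm x)
  have h4 : (4 : ℕ) ^ d = 2 ^ d * 2 ^ d := by
    rw [show (4 : ℕ) = 2 * 2 from rfl, mul_pow]
  -- trivial case `n < d`
  rcases le_or_gt d n with hdn | hnd
  swap
  · calc 2 ^ (n + 1) ≤ 2 ^ d * 2 ^ d := by
          rw [← pow_add]; exact Nat.pow_le_pow_right (by norm_num) (by omega)
      _ = 4 ^ d := h4.symm
      _ ≤ 3 ^ t * 4 ^ d := Nat.le_mul_of_pos_left _ (by positivity)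
  set Z := Finset.univ.filter fun x : Fin n → ZMod 2 => f x = false with hZ
  have ha : 2 ^ n ≤ Z.card * 2 ^ d := two_pow_le_card_zeros_mul hf hdn
  -- the subspace `K = P⁻¹(Q)`; its cosets through zeros stay inside the zero set
  set K : Submodule (ZMod 2) (Fin n → ZMod 2) := Q.comap P with hK
  have hcoset : ∀ x₀, f x₀ = false → ∀ k ∈ K, f (x₀ + k) = false := by
    intro x₀ hx₀ k hk
    obtain ⟨q, hq, hσ⟩ := (hrep' x₀).1 hx₀
    refine (hrep' (x₀ + k)).2 ⟨q - P k, Q.sub_mem hq (by simpa [hK] using hk), ?_⟩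
    have : P (x₀ + k) + (q - P k) = P x₀ + q := by rw [map_add]; abel
    rw [this]
    exact hσ
  -- `Z` is nonempty, so `dim K < d`
  have hZne : Z.Nonempty := by
    rw [Finset.nonempty_iff_ne_empty]
    rintro hZe
    rw [hZe, Finset.card_empty, zero_mul] at ha
    have h2n : 0 < 2 ^ n := by positivity
    omega
  obtain ⟨x₀, hx₀⟩ := hZne
  have hfx₀ : f x₀ = false := by simpa [hZ] using hx₀
  have hKd : Module.finrank (ZMod 2) K < d :=
    finrank_lt_of_isAffineDisperser_const hf x₀ K false (hcoset x₀ hfx₀)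
  have hcardK : Nat.card K = 2 ^ Module.finrank (ZMod 2) K := by
    rw [Module.natCard_eq_pow_finrank (K := ZMod 2), Nat.card_zmod]
  -- `Z ⊆ ⋃_{s ∈ σ_t⁻¹(1)} A s`, `A s = {x | s - P x ∈ Q}` empty or a coset of `K`
  let A : ZMod 2 × (Fin t → ZMod 2 × ZMod 2) → Finset (Fin n → ZMod 2) :=
    fun s => Finset.univ.filter fun x => s - P x ∈ Q
  set S := (Finset.univ.filter fun y : ZMod 2 × (Fin t → ZMod 2 × ZMod 2) => y.1 = 1 ∧ ∀ j, y.2 j ≠ 0)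
    with hS
  have hsub : Z ⊆ S.biUnion A := by
    intro x hx
    have hfx : f x = false := by simpa [hZ] using hx
    obtain ⟨q, hq, h1, h2⟩ := (hrep' x).1 hfx
    refine Finset.mem_biUnion.2 ⟨P x + q, (mem_sigmaSet _).2 ⟨h1, h2⟩, ?_⟩
    simp [A, hq]
  have hKF : (Finset.univ.filter fun x : Fin n → ZMod 2 => x ∈ K).card = Nat.card K := by
    rw [Nat.card_eq_fintype_card, Fintype.card_subtype]
  have hA : ∀ s ∈ S, (A s).card ≤ Nat.card K := by
    intro s _
    rcases (A s).eq_empty_or_nonempty with hAe | ⟨x₁, hx₁⟩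
    · rw [hAe, Finset.card_empty]; exact Nat.zero_le _
    have hx₁' : s - P x₁ ∈ Q := by simpa [A] using hx₁
    rw [← hKF]
    refine Finset.card_le_card_of_injOn (fun x => x - x₁) (fun x hx => ?_) ?_
    · have hx' : s - P x ∈ Q := by simpa [A] using hx
      have hmem : P (x - x₁) ∈ Q := by
        have : P (x - x₁) = (s - P x₁) - (s - P x) := by rw [map_sub]; abel
        rw [this]
        exact Q.sub_mem hx₁' hx'
      simpa [hK] using hmem
    · intro x _ y _ hxy
      exact sub_left_injective hxy
  have hb : Z.card ≤ 3 ^ t * Nat.card K := by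
    calc Z.card ≤ (S.biUnion A).card := Finset.card_le_card hsub
      _ ≤ ∑ s ∈ S, (A s).card := Finset.card_biUnion_le
      _ ≤ ∑ _s ∈ S, Nat.card K := Finset.sum_le_sum hA
      _ = 3 ^ t * Nat.card K := by rw [Finset.sum_const, smul_eq_mul, hS, card_sigmaSet]
  -- arithmetic: `2^n ≤ |Z|·2^d ≤ 3^t·2^{dim K}·2^d` and `2·2^{dim K} ≤ 2^d`
  have hpow : 2 * 2 ^ Module.finrank (ZMod 2) K ≤ 2 ^ d := by
    rw [← pow_succ']
    exact Nat.pow_le_pow_right (by norm_num) hKd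
  calc 2 ^ (n + 1) = 2 * 2 ^ n := by rw [pow_succ']
    _ ≤ 2 * (Z.card * 2 ^ d) := Nat.mul_le_mul_left _ ha
    _ ≤ 2 * (3 ^ t * Nat.card K * 2 ^ d) := Nat.mul_le_mul_left _ (Nat.mul_le_mul_right _ hb)
    _ = 3 ^ t * (2 * 2 ^ Module.finrank (ZMod 2) K) * 2 ^ d := by rw [hcardK]; ring
    _ ≤ 3 ^ t * 2 ^ d * 2 ^ d := Nat.mul_le_mul_right _ (Nat.mul_le_mul_left _ hpow)
    _ = 3 ^ t * 4 ^ d := by rw [h4, mul_assoc]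

end Summit.PneNP.PneNP.Cruxes.CircuitSuperlinear.Sketch
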